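import Mathlib
import Literature.MathematicalPhysics.QuantumFieldTheory.Balaban1983to89.B12CauchyRemainder354
import Literature.MathematicalPhysics.QuantumFieldTheory.Balaban1983to89.MatrixLog

/-!
# `Balaban1983to89.B14Eq369ThirdOrder` — [Balaban1988Convergent] (3.69)–(3.70) p. 284: the second proof of
Theorem 2, «we expand the terms up to the third order in B′»

HONEST FRAMING (cell `lit-balaban`, verbatim): statement-level skeleton of published theorems with citation tags;
proofs where landed; nothing here is a claim about the Yang–Mills mass gap.

CITATION HEADER.  T. Bałaban, *Convergent renormalization expansions for lattice gauge theories*, Commun. Math.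
Phys. **119** (1988) 243–285, doi:10.1007/bf01217741 [Balaban1988Convergent] (cell paper B14 = "[III]"; held text
`paper:balaban1988-cmp119-convergent-renormalization`, journal page = PDF page + 242; the displays below were READ AS
AN IMAGE from the page render `b2b-balaban-ref1/pages/1988-cmp119-convergent-renormalization/…-p042-x2.png`
(p. 284), the OCR layer being unusable for (3.69)–(3.72)).  Unit `lit-balaban-r11` (reader/typer of B14), SKELETON
row `B14.Claim@283alt` (§3 pp. 283–284, the sketch «another proof of Theorem 2 … we do not use the Ward–Takahashi
identities, but directly the gauge invariance»), sub-displays (3.69), (3.70); the sibling sub-displays are (3.68)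
(`B14Sect3.Ineq368Printed`, `ineq368_corrected`) and (3.71)–(3.72) (`B14.Eq372ContourBCH`).  [I] = T. Bałaban,
CMP **109** (1987) 249–301 [Balaban1987RG1] (cell paper B12).

WHAT IS PRINTED (p. 283 bottom – p. 284, verbatim up to typography).  *«Take the cube □₀ = □̃^{n−j+1} and the
representation U_k = U_{j,□₀}(M˙(U_k)). Now we repeat the construction of Sect. F [15], and we introduce the axial
gauge for the field M^j(U_k) on □₀, considering □₀ as one block with center at z. We denote the argument in the
representation by V′, i.e., V′ = M˙(U_k), and V′ is a small field, more precisely we have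
    |V′ − 1| < 11d²ε_n(L^jL^{−n})² + dM(n − j + 2)ε_n(L^jL^{−n})² < 3dM(1 + log L^jL^{−n})ε_n(L^jL^{−n})².   (3.68)
We write V′ = exp iB′, and we expand the terms up to the third order in B′. The third order terms are already
irrelevant by the above bound, hence
    𝐄^{(j)}(X, U_k, z) − 𝐄^{(j)}(X, 1, z) = ½⟨(δ²/δB′²)𝐄^{(j)}(X, U_{j,□₀}(1), z) B′, B′⟩
                                          + O(1)(L^jL^{−n})^{6−β} exp(−κd_j(X)).   (3.69)
In the quadratic form above we restrict B′ to □̃^{n−j}, and we replace the function U_{j,□₀} by U_j, the differences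
contribute to the last term only. Summing over X we get
    𝐄^{(j)}(Λ_j, U_k, z) − 𝐄^{(j)}(Λ_j, 1, z) = ½ Σ_{x,y,μ,ν} Π^{(j)}_{μν}(x, y, z) tr B′_μ(x)B′_ν(y) + O(1)(L^jL^{−n})⁵,   (3.70)
where the summation over x, y is restricted to □̃^{n−j}»* (and (3.71) defines B′(b) through the contour
Γ_{z,b₋} ∪ b ∪ Γ_{b₊,z}, typed in `B14.Eq372ContourBCH`).

WHY THERE IS NO FIRST-ORDER TERM IN (3.69).  The expansion «up to the third order» has a linear term
⟨(δ/δB′)𝐄^{(j)}(X, U_{j,□₀}(1), z), B′⟩; it vanishes by [I] (4.14) p. 284 *«Thus we have the first, very important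
consequence of the gauge invariance (δ/δB)𝐄(1) = 0. (4.14)»* (constant gauge transformations + semisimplicity of G).
As everywhere in the tree ([I] files `B12GaugeInv47.fderiv_one_eq_zero_of_gaugeInvariance` — caveat there —,
`B12Decay510R1.bForm_of_hForm`, `B12Eq46.eq420_of_eq414`) (4.14) enters as the NAMED HYPOTHESIS `h414`
(vanishing of the Fréchet derivative at B′ = 0 of the function of B′), not re-derived.

THE ARGUMENT, AS PRINTED, AND HOW IT IS FORMALIZED.  Fix X, z and write `f(B′) := 𝐄^{(j)}(X, U_{j,□₀}(exp iB′), z)`,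
a function on the real normed space `E` of the (𝔤-valued, axial-gauge) bond variables B′ on □₀, with values in a
complex Banach space `F` (print: `F = ℂ`, real on real fields); `f(0) = 𝐄^{(j)}(X, 1, z)` since U_{j,□₀}(1) = 1.
(§1) «expand … up to the third order in B′»: for `f` of class C³ on an open set containing the segment {τB′},
`f(B′) = f(0) + ⟨Df(0), B′⟩ + ½⟨D²f(0)B′, B′⟩ + ∫₀¹ dτ ((1 − τ)²/2!) ⟨D³f(τB′), ⊗³B′⟩` (`taylor3_ray`, the order-3
sibling of `B12Taylor334.taylor334`, from Mathlib's `taylor_integral_remainder`), and with `h414` the linear term drops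
(`expansion369`).  (§2) «The third order terms are already irrelevant»: exactly as for [I] (3.54)
(`B12CauchyRemainder354.ineq354`, fifth order) — if the ray function agrees near each τ ∈ [0, 1] with a function Φ
holomorphic and bounded by `M` on the discs `|σ − τ| < r` (print's inputs: the analyticity (2.27)(ii) of 𝐄^{(j)}(X, ·, z)
on the complex space Ũ_j^c(X, α_{0,j}, α_{1,j}) along B′ ↦ exp i(τ + σ)B′, radius `r = ρ/|B′|`, and the bound
(2.27)(iv) `M = E₀ exp(−κd_j(X))`), then Cauchy's estimate gives `‖Φ‴(τ)‖ ≤ 3! M r⁻³` and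
`∫₀¹ (1 − τ)²/2! dτ = 1/3!`, so the cubic remainder has norm `≤ M r⁻³ = E₀ ρ⁻³ |B′|³ exp(−κd_j(X))`
(`cubicRemainder_norm_le`, `remainder369_norm_le`, `remainder369_norm_le_printed`); hence **(3.69)**:
`‖f(B′) − f(0) − ½⟨D²f(0)B′, B′⟩‖ ≤ E₀ ρ⁻³ |B′|³ exp(−κd_j(X))` (`eq369`).  (§3) «by the above bound»: (3.68) and
B7 (26) give `|B′| = |(1/i) log V′| ≤ 2|V′ − 1| ≤ 2·3dM(1 + log L^{n−j})ε_n(L^jL^{−n})²` (`norm_Bprime_le_of_368`,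
via `MatrixLog.norm_mlog_le_two_mul`), so `|B′| ≤ b·t²` with `t = L^jL^{−n}`; if the small factors absorb the radius,
`(b/ρ)³ ≤ C t^{−β}` (print's «irrelevant», the ε_n and logarithms being paid by t^{−β}), the remainder is
`≤ (E₀C)·t^{6−β}·exp(−κd_j(X))` — the printed right member of (3.69) with O(1) = E₀C (`eq369_printed`).
(§4) **(3.70)**, «Summing over X»: the summed quadratic terms ARE a kernel double sum,
`Σ_X ⟨D²f_X(0)B′, B′⟩ = Σ_{b,b′} Π(b, b′)(B′(b), B′(b′))` with the bilinear-form-valued kernel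
`Π(b, b′)(u, v) := Σ_X D²f_X(0)(δ_b u, δ_{b′} v)` (`kernel370`, `sum_quadratic_eq_kernel370`; print's scalar form
`Π^{(j)}_{μν}(x, y, z) tr(uv)`, b = ⟨x, x + e_μ⟩, b′ = ⟨y, y + e_ν⟩, is the invariant special case, cf. (3.50)
`B14.Eq350Kernel.kernel350`), and the summed remainders obey
`Σ_{X∋z} O(1)t^{6−β}exp(−κd_j(X)) ≤ O(1)·K·t⁵` for `t ≤ 1`, `β ≤ 1` and `Σ_{X∋z} exp(−κd_j(X)) ≤ K` (`eq370`); the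
two replacements («restrict B′ to □̃^{n−j}», «replace U_{j,□₀} by U_j») «contribute to the last term only» — their
(undisplayed) O(t⁵) bound is the hypothesis `hrepl` of `eq370_replaced`.

WHAT IS PROVED (kernel-checked, no `sorry`, standard axioms): every theorem below.  Definitions: `kernel370` only.

WHAT IS NOT PROVED HERE (and not claimed): (4.14) [I] itself (hypothesis `h414`); the analyticity and the bound of
𝐄^{(j)}(X, ·, z) on the complex spaces ((2.27)(ii),(iv) — hypotheses `hΦ`, `hM`, `hagree`); the absorption
`(b/ρ)³ ≤ Ct^{−β}` of ε_n(1 + log L^{n−j})³ρ⁻³ (hypothesis `habs`; print: «already irrelevant by the above bound»);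
the bounds behind «the differences contribute to the last term only» (hypothesis `hrepl`); (3.68) itself (row
`B14Sect3.Ineq368Printed`, whose second inequality fails as printed — `B14Sect3.ineq368_printed_fails` — and is used
here only through an abstract bound `|V′ − 1| ≤ δ ≤ ½`); the identification of the first term of (3.70) with (3.57)
via (3.71)–(3.72) (`B14.Eq372ContourBCH.eq372` gives the contour expansion; the plaquette/bond relocation to z is
not typed).  v1.1 (§5) adds the two sentences on the SECOND CLASS of localization domains (p. 283, before
(3.68)): `second_class_le` (`2E₀exp(−½κ(n−j))exp(−½κd_j(X))` from the inductive bound and `d_j(X) ≥ n − j`),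
`exp_half_kappa_le_pow_five` (`exp(−½κ(n−j)) ≤ (L^jL^{−n})⁵` under `10 log L ≤ κ`), `second_class_irrelevant`.
NOT summit progress: bookkeeping of two printed displays of a proof sketch.
-/

namespace Literature.MathematicalPhysics.QuantumFieldTheory.Balaban1983to89.B14.Eq369ThirdOrder

open Set Filter Metric
open scoped Topology Nat

/-! ## §1. «we expand the terms up to the third order in B′» — the third-order expansion along the ray -/

section Taylor3

variable {E F : Type*} [NormedAddCommGroup E] [NormedSpace ℝ E] [NormedAddCommGroup F] [NormedSpace ℝ F]
  [CompleteSpace F]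

/-- One-variable form of the expansion «up to the third order»: for `g : ℝ → F` of class `C³` on `[0, 1]`,
`g(1) = Σ_{n=0}^{2} (1/n!) g⁽ⁿ⁾(0) + ∫₀¹ ((1 − τ)²/2!) g⁽³⁾(τ) dτ` (derivatives within `[0, 1]`; Mathlib's
`taylor_integral_remainder`). [cite: Balaban1988Convergent, (3.69) p.284] -/
theorem taylor3_integral_remainder {g : ℝ → F} (hg : ContDiffOn ℝ 3 g (Icc (0 : ℝ) 1)) :
    g 1 = ∑ n ∈ Finset.range 3, ((n ! : ℝ)⁻¹) • iteratedDerivWithin n g (Icc 0 1) 0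
      + ∫ τ in (0 : ℝ)..1, ((1 - τ) ^ 2 / (2 ! : ℝ)) • iteratedDerivWithin 3 g (Icc 0 1) τ := by
  have hI : uIcc (0 : ℝ) 1 = Icc 0 1 := uIcc_of_le zero_le_one
  have h := taylor_integral_remainder (f := g) (x₀ := (0 : ℝ)) (x := 1) (n := 2) (by
    rw [hI]; exact_mod_cast hg)
  rw [hI, taylor_within_apply] at h
  simp only [sub_zero, one_pow, mul_one] at h
  rw [← h]
  abel

omit [CompleteSpace F] in
/-- Chain rule along the ray (order-3 sibling of `B12Taylor334.iteratedDeriv_comp_ray`): for `f` of class `C³` on an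
open set `s` and `τB′ ∈ s`, the `n`-th derivative (`n ≤ 3`) of `τ ↦ f(τB′)` at `τ` is `⟨Dⁿf(τB′), ⊗ⁿB′⟩`.
[cite: Balaban1988Convergent, (3.69) p.284] -/
theorem iteratedDeriv_comp_ray {s : Set E} (hs : IsOpen s) {f : E → F} (hf : ContDiffOn ℝ 3 f s) (B : E)
    {τ : ℝ} (hτ : τ • B ∈ s) {n : ℕ} (hn : n ≤ 3) :
    iteratedDeriv n (fun t : ℝ => f (t • B)) τ = iteratedFDeriv ℝ n f (τ • B) (fun _ => B) := by
  have hs' : IsOpen ((ContinuousLinearMap.toSpanSingleton ℝ B) ⁻¹' s) :=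
    hs.preimage (ContinuousLinearMap.toSpanSingleton ℝ B).continuous
  have hτ' : τ ∈ (ContinuousLinearMap.toSpanSingleton ℝ B) ⁻¹' s := by simpa using hτ
  have hcomp : (fun t : ℝ => f (t • B)) = f ∘ (ContinuousLinearMap.toSpanSingleton ℝ B) := by
    funext t; simp
  rw [iteratedDeriv_eq_iteratedFDeriv, hcomp, ← iteratedFDerivWithin_of_isOpen n hs' hτ',
    (ContinuousLinearMap.toSpanSingleton ℝ B).iteratedFDerivWithin_comp_right hf hs.uniqueDiffOn hs'.uniqueDiffOn
      (x := τ) (by simpa using hτ) (i := n) (by exact_mod_cast hn),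
    ContinuousMultilinearMap.compContinuousLinearMap_apply]
  simp only [ContinuousLinearMap.toSpanSingleton_apply, one_smul]
  exact congrArg (fun m : ContinuousMultilinearMap ℝ (fun _ : Fin n => E) F => m (fun _ => B))
    (iteratedFDerivWithin_of_isOpen (𝕜 := ℝ) (f := f) n hs hτ)

/-- **«we expand the terms up to the third order in B′»** (p. 284), multilinear form: for `f : E → F` (`F` complete)
of class `C³` on an open set `s ⊆ E` containing the segment `{τB′ : 0 ≤ τ ≤ 1}` (in print
`f(B′) = 𝐄^{(j)}(X, U_{j,□₀}(exp iB′), z)`, analytic by (2.27)(ii) on a complex neighbourhood of the segment),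
`f(B′) = Σ_{n=0}^{2} (1/n!) ⟨Dⁿf(0), ⊗ⁿB′⟩ + ∫₀¹ dτ ((1 − τ)²/2!) ⟨D³f(τB′), ⊗³B′⟩`.
[cite: Balaban1988Convergent, (3.69) p.284] -/
theorem taylor3_ray {s : Set E} (hs : IsOpen s) {f : E → F} (hf : ContDiffOn ℝ 3 f s) (B : E)
    (hB : ∀ τ ∈ Icc (0 : ℝ) 1, τ • B ∈ s) :
    f B = ∑ n ∈ Finset.range 3, ((n ! : ℝ)⁻¹) • iteratedFDeriv ℝ n f 0 (fun _ => B)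
      + ∫ τ in (0 : ℝ)..1, ((1 - τ) ^ 2 / (2 ! : ℝ)) • iteratedFDeriv ℝ 3 f (τ • B) (fun _ => B) := by
  set g : ℝ → F := fun t => f (t • B) with hg_def
  have hs' : IsOpen ((ContinuousLinearMap.toSpanSingleton ℝ B) ⁻¹' s) :=
    hs.preimage (ContinuousLinearMap.toSpanSingleton ℝ B).continuous
  have hsub : Icc (0 : ℝ) 1 ⊆ (ContinuousLinearMap.toSpanSingleton ℝ B) ⁻¹' s := fun τ hτ => by
    simpa using hB τ hτ
  have hg' : ContDiffOn ℝ 3 g ((ContinuousLinearMap.toSpanSingleton ℝ B) ⁻¹' s) := by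
    have : g = f ∘ (ContinuousLinearMap.toSpanSingleton ℝ B) := by funext t; simp [hg_def]
    rw [this]
    exact hf.comp (ContinuousLinearMap.toSpanSingleton ℝ B).contDiff.contDiffOn (fun x hx => hx)
  have hg : ContDiffOn ℝ 3 g (Icc (0 : ℝ) 1) := hg'.mono hsub
  have hkey : ∀ τ ∈ Icc (0 : ℝ) 1, ∀ n ≤ 3,
      iteratedDerivWithin n g (Icc 0 1) τ = iteratedFDeriv ℝ n f (τ • B) (fun _ => B) := by
    intro τ hτ n hn
    have hτ' : τ ∈ (ContinuousLinearMap.toSpanSingleton ℝ B) ⁻¹' s := hsub hτ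
    have hat : ContDiffAt ℝ 3 g τ := hg'.contDiffAt (hs'.mem_nhds hτ')
    rw [iteratedDerivWithin_eq_iteratedDeriv (uniqueDiffOn_Icc zero_lt_one)
      (hat.of_le (by exact_mod_cast hn)) hτ]
    exact iteratedDeriv_comp_ray hs hf B (by simpa using hτ') hn
  have h1 := taylor3_integral_remainder hg
  have hg1 : g 1 = f B := by simp [hg_def]
  rw [hg1] at h1
  rw [h1]
  congr 1
  · refine Finset.sum_congr rfl fun n hn => ?_
    have hn3 : n ≤ 3 := by
      have := Finset.mem_range.mp hn; omega
    rw [hkey 0 ⟨le_rfl, zero_le_one⟩ n hn3, zero_smul]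
  · refine intervalIntegral.integral_congr fun τ hτ => ?_
    rw [uIcc_of_le zero_le_one] at hτ
    simp only [hkey τ hτ 3 le_rfl]

/-- **(3.69), the expansion with the linear term dropped**: under [I] (4.14) for the function of B′ — the NAMED
HYPOTHESIS `h414 : Df(0) = 0` ([I] p. 284 «(δ/δB)𝐄(1) = 0. (4.14)», constant gauge transformations + semisimplicity;
tree convention of `B12GaugeInv47`/`B12Decay510R1`) —
`f(B′) − f(0) = ½⟨D²f(0)B′, B′⟩ + ∫₀¹ dτ ((1 − τ)²/2!) ⟨D³f(τB′), ⊗³B′⟩`; in print `f(0) = 𝐄^{(j)}(X, 1, z)` because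
`U_{j,□₀}(1) = 1`, and the integral is «the third order terms».
[cite: Balaban1988Convergent, (3.69) p.284; Balaban1987RG1, (4.14) p.284] -/
theorem expansion369 {s : Set E} (hs : IsOpen s) {f : E → F} (hf : ContDiffOn ℝ 3 f s) (B : E)
    (hB : ∀ τ ∈ Icc (0 : ℝ) 1, τ • B ∈ s) (h414 : fderiv ℝ f 0 = 0) :
    f B - f 0 = (2 : ℝ)⁻¹ • iteratedFDeriv ℝ 2 f 0 (fun _ => B)
      + ∫ τ in (0 : ℝ)..1, ((1 - τ) ^ 2 / (2 ! : ℝ)) • iteratedFDeriv ℝ 3 f (τ • B) (fun _ => B) := by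
  rw [taylor3_ray hs hf B hB]
  simp only [Finset.sum_range_succ, Finset.sum_range_zero, zero_add, Nat.factorial_zero, Nat.factorial_one,
    Nat.factorial_two, Nat.cast_one, inv_one, one_smul, iteratedFDeriv_zero_apply, iteratedFDeriv_one_apply, h414,
    _root_.zero_apply, smul_zero, add_zero, Nat.cast_ofNat]
  abel

end Taylor3

/-! ## §2. «The third order terms are already irrelevant»: Cauchy's estimate of the cubic remainder -/

section Cauchy

variable {F : Type*} [NormedAddCommGroup F] [NormedSpace ℂ F] [CompleteSpace F]

/-- **The cubic remainder by Cauchy's estimate**, in one complex variable along the ray (order-3 sibling of [I]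
(3.54), `B12CauchyRemainder354.ineq354`): if `Φ` (in print `Φ(ζ) = 𝐄^{(j)}(X, U_{j,□₀}(exp iζB′), z)`) is holomorphic
on `ball τ r` with `‖Φ‖ ≤ M` there, for every `τ ∈ [0, 1]` ((2.27)(ii),(iv): analyticity on Ũ_j^c(X, α_{0,j}, α_{1,j})
and the bound E₀exp(−κd_j(X))), then `‖∫₀¹ dτ ((1 − τ)²/2!) Φ‴(τ)‖ ≤ M / r³`
(Cauchy: `‖Φ‴(τ)‖ ≤ 3! M r⁻³`, and `∫₀¹ (1 − τ)²/2! dτ = 1/3!`). [cite: Balaban1988Convergent, (3.69) p.284] -/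
theorem cubicRemainder_norm_le {Φ : ℂ → F} {r M : ℝ} (hr : 0 < r)
    (hΦ : ∀ τ ∈ Icc (0 : ℝ) 1, DifferentiableOn ℂ Φ (ball (τ : ℂ) r))
    (hM : ∀ τ ∈ Icc (0 : ℝ) 1, ∀ z ∈ ball (τ : ℂ) r, ‖Φ z‖ ≤ M) :
    ‖∫ τ in (0 : ℝ)..1, ((1 - τ) ^ 2 / (2 ! : ℝ)) • iteratedDeriv 3 Φ (τ : ℂ)‖ ≤ M / r ^ 3 := by
  have h3 : ∀ τ ∈ Icc (0 : ℝ) 1, ‖iteratedDeriv 3 Φ (τ : ℂ)‖ ≤ 3 ! * M / r ^ 3 :=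
    fun τ hτ => B12CauchyRemainder354.norm_iteratedDeriv_le_of_ball hr (hΦ τ hτ) (hM τ hτ) 3
  have hle : ‖∫ τ in (0 : ℝ)..1, ((1 - τ) ^ 2 / (2 ! : ℝ)) • iteratedDeriv 3 Φ (τ : ℂ)‖
      ≤ ∫ τ in (0 : ℝ)..1, (1 - τ) ^ 2 / (2 ! : ℝ) * (3 ! * M / r ^ 3) := by
    refine intervalIntegral.norm_integral_le_of_norm_le zero_le_one ?_ ?_
    · refine Filter.Eventually.of_forall fun τ hτ => ?_
      have hτ' : τ ∈ Icc (0 : ℝ) 1 := Ioc_subset_Icc_self hτ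
      have hw : 0 ≤ (1 - τ) ^ 2 / (2 ! : ℝ) := by
        have : 0 ≤ 1 - τ := by linarith [hτ'.2]
        positivity
      rw [norm_smul, Real.norm_of_nonneg hw]
      exact mul_le_mul_of_nonneg_left (h3 τ hτ') hw
    · exact (by fun_prop : Continuous fun τ : ℝ => (1 - τ) ^ 2 / (2 ! : ℝ) * (3 ! * M / r ^ 3)).intervalIntegrable _ _
  refine hle.trans (le_of_eq ?_)
  have hint : ∫ τ in (0 : ℝ)..1, (1 - τ) ^ 2 = 1 / 3 := by
    have h := intervalIntegral.integral_comp_sub_left (a := (0 : ℝ)) (b := 1) (fun x : ℝ => x ^ 2) (1 : ℝ)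
    simp only [sub_self, sub_zero] at h
    rw [h, integral_pow]
    norm_num
  rw [intervalIntegral.integral_mul_const, intervalIntegral.integral_div, hint]
  have h2 : ((2 ! : ℕ) : ℝ) = 2 := by norm_num [Nat.factorial]
  have h3' : ((3 ! : ℕ) : ℝ) = 6 := by norm_num [Nat.factorial]
  rw [h2, h3']
  field_simp
  ring

section Ray

variable {E : Type*} [NormedAddCommGroup E] [NormedSpace ℝ E]

/-- The integrand of «the third order terms» is the third complex derivative along the ray: for `f` of class `C³` on
an open `s ∋ τB′`, agreeing near the real point `τ` along the ray with a `Φ` holomorphic on `ball τ r`,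
`⟨D³f(τB′), ⊗³B′⟩ = Φ‴(τ)`. [cite: Balaban1988Convergent, (3.69) p.284] -/
theorem iteratedFDeriv_ray_eq_iteratedDeriv {s : Set E} (hs : IsOpen s) {f : E → F} (hf : ContDiffOn ℝ 3 f s)
    (B : E) {τ r : ℝ} (hr : 0 < r) (hτB : τ • B ∈ s) {Φ : ℂ → F} (hΦ : DifferentiableOn ℂ Φ (ball (τ : ℂ) r))
    (hagree : ∀ᶠ t : ℝ in 𝓝 τ, f (t • B) = Φ (t : ℂ)) :
    iteratedFDeriv ℝ 3 f (τ • B) (fun _ => B) = iteratedDeriv 3 Φ (τ : ℂ) := by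
  rw [← iteratedDeriv_comp_ray hs hf B hτB le_rfl, Filter.EventuallyEq.iteratedDeriv_eq 3 hagree]
  exact B12CauchyRemainder354.iteratedDeriv_comp_ofReal isOpen_ball 3 hΦ (mem_ball_self hr)

/-- **«The third order terms», bounded**: for `f` of class `C³` on an open `s ⊇ {τB′ : τ ∈ [0,1]}` whose ray function
`t ↦ f(tB′)` agrees near each `τ ∈ [0, 1]` with a `Φ` holomorphic and bounded by `M` on `ball τ r`,
`‖∫₀¹ dτ ((1 − τ)²/2!) ⟨D³f(τB′), ⊗³B′⟩‖ ≤ M / r³`. [cite: Balaban1988Convergent, (3.69) p.284] -/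
theorem remainder369_norm_le {s : Set E} (hs : IsOpen s) {f : E → F} (hf : ContDiffOn ℝ 3 f s) (B : E)
    (hB : ∀ τ ∈ Icc (0 : ℝ) 1, τ • B ∈ s) {Φ : ℂ → F} {r M : ℝ} (hr : 0 < r)
    (hΦ : ∀ τ ∈ Icc (0 : ℝ) 1, DifferentiableOn ℂ Φ (ball (τ : ℂ) r))
    (hM : ∀ τ ∈ Icc (0 : ℝ) 1, ∀ z ∈ ball (τ : ℂ) r, ‖Φ z‖ ≤ M)
    (hagree : ∀ τ ∈ Icc (0 : ℝ) 1, ∀ᶠ t : ℝ in 𝓝 τ, f (t • B) = Φ (t : ℂ)) :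
    ‖∫ τ in (0 : ℝ)..1, ((1 - τ) ^ 2 / (2 ! : ℝ)) • iteratedFDeriv ℝ 3 f (τ • B) (fun _ => B)‖ ≤ M / r ^ 3 := by
  have heq : (∫ τ in (0 : ℝ)..1, ((1 - τ) ^ 2 / (2 ! : ℝ)) • iteratedFDeriv ℝ 3 f (τ • B) (fun _ => B))
      = ∫ τ in (0 : ℝ)..1, ((1 - τ) ^ 2 / (2 ! : ℝ)) • iteratedDeriv 3 Φ (τ : ℂ) := by
    refine intervalIntegral.integral_congr fun τ hτ => ?_
    rw [uIcc_of_le zero_le_one] at hτ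
    simp only [iteratedFDeriv_ray_eq_iteratedDeriv hs hf B hr (hB τ hτ) (hΦ τ hτ) (hagree τ hτ)]
  rw [heq]
  exact cubicRemainder_norm_le hr hΦ hM

/-- **«The third order terms», printed constants**: radius `r = ρ/‖B′‖` (`B′ ≠ 0`; `ρ` = the analyticity radius of
(2.27)(ii) in the direction of B′) and `M = E₀ exp(−κd_j(X))` ((2.27)(iv)):
`‖∫₀¹ dτ ((1 − τ)²/2!) ⟨D³f(τB′), ⊗³B′⟩‖ ≤ E₀ ρ⁻³ ‖B′‖³ exp(−κd_j(X))`. [cite: Balaban1988Convergent, (3.69) p.284] -/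
theorem remainder369_norm_le_printed {s : Set E} (hs : IsOpen s) {f : E → F} (hf : ContDiffOn ℝ 3 f s) {B : E}
    (hB0 : B ≠ 0) (hB : ∀ τ ∈ Icc (0 : ℝ) 1, τ • B ∈ s) {Φ : ℂ → F} {ρ E₀ κ d : ℝ} (hρ : 0 < ρ)
    (hΦ : ∀ τ ∈ Icc (0 : ℝ) 1, DifferentiableOn ℂ Φ (ball (τ : ℂ) (ρ / ‖B‖)))
    (hM : ∀ τ ∈ Icc (0 : ℝ) 1, ∀ z ∈ ball (τ : ℂ) (ρ / ‖B‖), ‖Φ z‖ ≤ E₀ * Real.exp (-(κ * d)))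
    (hagree : ∀ τ ∈ Icc (0 : ℝ) 1, ∀ᶠ t : ℝ in 𝓝 τ, f (t • B) = Φ (t : ℂ)) :
    ‖∫ τ in (0 : ℝ)..1, ((1 - τ) ^ 2 / (2 ! : ℝ)) • iteratedFDeriv ℝ 3 f (τ • B) (fun _ => B)‖
      ≤ E₀ * ρ⁻¹ ^ 3 * ‖B‖ ^ 3 * Real.exp (-(κ * d)) := by
  have hnB : 0 < ‖B‖ := norm_pos_iff.mpr hB0
  have h := remainder369_norm_le hs hf B hB (div_pos hρ hnB) hΦ hM hagree
  refine h.trans (le_of_eq ?_)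
  field_simp

/-- **(3.69)** p. 284 [PDF 42]: under [I] (4.14) for the function of B′ (`h414`) and the analyticity inputs of
`remainder369_norm_le`,
`‖𝐄^{(j)}(X, U_k, z) − 𝐄^{(j)}(X, 1, z) − ½⟨(δ²/δB′²)𝐄^{(j)}(X, U_{j,□₀}(1), z)B′, B′⟩‖ ≤ M / r³`
— i.e. `f(B′) − f(0) = ½⟨D²f(0)B′, B′⟩ + O(M r⁻³)` with O-constant 1.
[cite: Balaban1988Convergent, (3.69) p.284; Balaban1987RG1, (4.14) p.284] -/
theorem eq369 {s : Set E} (hs : IsOpen s) {f : E → F} (hf : ContDiffOn ℝ 3 f s) (B : E)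
    (hB : ∀ τ ∈ Icc (0 : ℝ) 1, τ • B ∈ s) (h414 : fderiv ℝ f 0 = 0) {Φ : ℂ → F} {r M : ℝ} (hr : 0 < r)
    (hΦ : ∀ τ ∈ Icc (0 : ℝ) 1, DifferentiableOn ℂ Φ (ball (τ : ℂ) r))
    (hM : ∀ τ ∈ Icc (0 : ℝ) 1, ∀ z ∈ ball (τ : ℂ) r, ‖Φ z‖ ≤ M)
    (hagree : ∀ τ ∈ Icc (0 : ℝ) 1, ∀ᶠ t : ℝ in 𝓝 τ, f (t • B) = Φ (t : ℂ)) :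
    ‖f B - f 0 - (2 : ℝ)⁻¹ • iteratedFDeriv ℝ 2 f 0 (fun _ => B)‖ ≤ M / r ^ 3 := by
  rw [expansion369 hs hf B hB h414, add_sub_cancel_left]
  exact remainder369_norm_le hs hf B hB hr hΦ hM hagree

/-- **(3.69) with the printed constants before the absorption**: `r = ρ/‖B′‖`, `M = E₀exp(−κd_j(X))` give
`‖f(B′) − f(0) − ½⟨D²f(0)B′, B′⟩‖ ≤ E₀ ρ⁻³ ‖B′‖³ exp(−κd_j(X))` (for `B′ = 0` both members vanish).
[cite: Balaban1988Convergent, (3.69) p.284] -/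
theorem eq369_cubic {s : Set E} (hs : IsOpen s) {f : E → F} (hf : ContDiffOn ℝ 3 f s) (B : E)
    (hB : ∀ τ ∈ Icc (0 : ℝ) 1, τ • B ∈ s) (h414 : fderiv ℝ f 0 = 0) {Φ : ℂ → F} {ρ E₀ κ d : ℝ} (hρ : 0 < ρ)
    (hΦ : ∀ τ ∈ Icc (0 : ℝ) 1, DifferentiableOn ℂ Φ (ball (τ : ℂ) (ρ / ‖B‖)))
    (hM : ∀ τ ∈ Icc (0 : ℝ) 1, ∀ z ∈ ball (τ : ℂ) (ρ / ‖B‖), ‖Φ z‖ ≤ E₀ * Real.exp (-(κ * d)))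
    (hagree : ∀ τ ∈ Icc (0 : ℝ) 1, ∀ᶠ t : ℝ in 𝓝 τ, f (t • B) = Φ (t : ℂ)) :
    ‖f B - f 0 - (2 : ℝ)⁻¹ • iteratedFDeriv ℝ 2 f 0 (fun _ => B)‖
      ≤ E₀ * ρ⁻¹ ^ 3 * ‖B‖ ^ 3 * Real.exp (-(κ * d)) := by
  by_cases hB0 : B = 0
  · subst hB0
    have h0 : iteratedFDeriv ℝ 2 f 0 (fun _ => (0 : E)) = 0 :=
      (iteratedFDeriv ℝ 2 f 0).map_zero
    simp [h0]
  · rw [expansion369 hs hf B hB h414, add_sub_cancel_left]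
    exact remainder369_norm_le_printed hs hf hB0 hB hρ hΦ hM hagree

end Ray

end Cauchy

/-! ## §3. «by the above bound»: (3.68) ⇒ |B′| ≤ 2|V′ − 1|, and the absorption into O(1)(L^jL^{−n})^{6−β} -/

section Irrelevant

variable {𝔄 : Type*} [NormedRing 𝔄] [NormedAlgebra ℂ 𝔄] [CompleteSpace 𝔄]

/-- **«We write V′ = exp iB′ … by the above bound»**: with `B′ = (1/i) log V′` (the logarithm of B7 (21),
`MatrixLog.mlog`, `exp(mlog V′) = V′` for `|V′ − 1| < 1`) and (3.68) in the abstract form `|V′ − 1| ≤ δ ≤ ½`,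
B7 (26) gives `|B′| ≤ 2δ` (`MatrixLog.norm_mlog_le_two_mul`); in print `δ = 3dM(1 + log L^{n−j})ε_n(L^jL^{−n})²`.
[cite: Balaban1988Convergent, (3.68)-(3.69) p.284] -/
theorem norm_Bprime_le_of_368 {V : 𝔄} {δ : ℝ} (hV : ‖V - 1‖ ≤ δ) (hδ : δ ≤ 1 / 2) :
    ‖(-Complex.I) • MatrixLog.mlog V‖ ≤ 2 * δ := by
  rw [norm_smul, norm_neg, Complex.norm_I, one_mul]
  exact (MatrixLog.norm_mlog_le_two_mul (hV.trans hδ)).trans (by linarith)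

/-- **«The third order terms are already irrelevant by the above bound»** — the absorption, as real bookkeeping
(`t = L^jL^{−n}`): if the cubic remainder obeys `R ≤ E₀ρ⁻³|B′|³e` (`eq369_cubic`, `e = exp(−κd_j(X))`), (3.68) gives
`|B′| ≤ b·t²` (`norm_Bprime_le_of_368`, `b = 2·3dM(1 + log L^{n−j})ε_n`), and the small factors absorb the radius,
`(b/ρ)³ ≤ C·t^{−β}` (print's «irrelevant»: ε_n³(1 + log L^{n−j})³ρ⁻³ is paid by t^{−β}, β > 0), then
`R ≤ (E₀C)·t^{6−β}·e` — the right member of (3.69) with O(1) = E₀C. [cite: Balaban1988Convergent, (3.69) p.284] -/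
theorem eq369_printed {R E₀ ρ nB e b t β C : ℝ} (hE₀ : 0 ≤ E₀) (hρ : 0 < ρ) (he : 0 ≤ e) (hnB : 0 ≤ nB)
    (ht : 0 < t) (h369 : R ≤ E₀ * ρ⁻¹ ^ 3 * nB ^ 3 * e) (h368 : nB ≤ b * t ^ 2)
    (habs : (b / ρ) ^ 3 ≤ C * t ^ (-β)) :
    R ≤ E₀ * C * t ^ (6 - β) * e := by
  have hρinv : 0 ≤ ρ⁻¹ := inv_nonneg.mpr hρ.le
  have h6 : t ^ (6 - β) = t ^ (6 : ℕ) * t ^ (-β) := by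
    rw [show (6 : ℝ) - β = ((6 : ℕ) : ℝ) + -β by push_cast; ring, Real.rpow_add ht, Real.rpow_natCast]
  calc R ≤ E₀ * ρ⁻¹ ^ 3 * nB ^ 3 * e := h369
    _ ≤ E₀ * ρ⁻¹ ^ 3 * (b * t ^ 2) ^ 3 * e := by gcongr
    _ = E₀ * (b / ρ) ^ 3 * t ^ 6 * e := by rw [div_eq_mul_inv]; ring
    _ ≤ E₀ * (C * t ^ (-β)) * t ^ 6 * e := by gcongr
    _ = E₀ * C * t ^ (6 - β) * e := by rw [h6]; ring

end Irrelevant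

/-! ## §4. (3.70): «Summing over X» — the kernel form of the quadratic term and the summed remainder -/

section Kernel

variable {ι : Type*} [Fintype ι] [DecidableEq ι] {𝔤 : Type*} [NormedAddCommGroup 𝔤] [NormedSpace ℝ 𝔤]
  {F : Type*} [NormedAddCommGroup F] [NormedSpace ℝ F] {𝒳 : Type*}

/-- **The kernel of (3.70)**, bilinear-form-valued: `Π(b, b′)(u, v) := Σ_{X} δ²f_X/(δB′(b)δB′(b′))|₀ (δ_b u, δ_{b′} v)`,
the sum over the localization domains `X ∈ s` (print: X ∋ z, X ⊂ Λ_j, after the two replacements) of the second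
Fréchet derivatives of `f_X(B′) = 𝐄^{(j)}(X, U_j(exp iB′), z)` at `0` on the coordinate directions of the bonds
`b, b′` (index type `ι` = the bonds of □̃^{n−j} with their direction, `b = ⟨x, x + e_μ⟩`).  Print's
`Π^{(j)}_{μν}(x, y, z) tr B′_μ(x)B′_ν(y)` is the invariant special case `Π(b, b′)(u, v) = Π^{(j)}_{μν}(x, y, z)·tr(uv)`
(cf. (3.50), `B14.Eq350Kernel.kernel350`/`E2`). [cite: Balaban1988Convergent, (3.70) p.284] -/
noncomputable def kernel370 (f : 𝒳 → (ι → 𝔤) → F) (s : Finset 𝒳) (b b' : ι) (u v : 𝔤) : F :=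
  ∑ X ∈ s, fderiv ℝ (fderiv ℝ (f X)) 0 (Pi.single b u) (Pi.single b' v)

/-- Bilinear bookkeeping on the finite configuration space: a continuous bilinear map evaluated on `(v, w)` is the
double sum of its values on the coordinate components. [folklore] -/
private theorem bilin_apply_eq_sum (L : (ι → 𝔤) →L[ℝ] (ι → 𝔤) →L[ℝ] F) (v w : ι → 𝔤) :
    L v w = ∑ i, ∑ j, L (Pi.single i (v i)) (Pi.single j (w j)) := by
  have hv : (∑ i, Pi.single i (v i)) = v := Finset.univ_sum_single v
  have hw : (∑ j, Pi.single j (w j)) = w := Finset.univ_sum_single w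
  calc L v w = L (∑ i, Pi.single i (v i)) w := by rw [hv]
    _ = ∑ i, L (Pi.single i (v i)) w := by
        rw [map_sum, FunLike.coe_sum, Finset.sum_apply]
    _ = ∑ i, ∑ j, L (Pi.single i (v i)) (Pi.single j (w j)) :=
        Finset.sum_congr rfl fun i _ => by
          conv_lhs => rw [← hw]
          rw [map_sum]

/-- **(3.70), the first term**: «Summing over X» the quadratic terms of (3.69) gives the kernel double sum,
`Σ_{X∈s} ⟨D²f_X(0)B′, B′⟩ = Σ_{b,b′} Π(b, b′)(B′(b), B′(b′))` — print's `Σ_{x,y,μ,ν} Π^{(j)}_{μν}(x, y, z) tr B′_μ(x)B′_ν(y)`.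
[cite: Balaban1988Convergent, (3.70) p.284] -/
theorem sum_quadratic_eq_kernel370 (f : 𝒳 → (ι → 𝔤) → F) (s : Finset 𝒳) (B : ι → 𝔤) :
    ∑ X ∈ s, iteratedFDeriv ℝ 2 (f X) 0 (fun _ => B) = ∑ b, ∑ b', kernel370 f s b b' (B b) (B b') := by
  simp only [kernel370, iteratedFDeriv_two_apply, bilin_apply_eq_sum _ B B]
  rw [Finset.sum_comm]
  refine Finset.sum_congr rfl fun b _ => ?_
  rw [Finset.sum_comm]

end Kernel

section Summing

variable {𝒳 F : Type*} [NormedAddCommGroup F] [NormedSpace ℝ F]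

/-- **(3.70), «Summing over X we get … + O(1)(L^jL^{−n})⁵»** (`t = L^jL^{−n} ≤ 1`): if every localization domain
`X ∈ s` (X ∋ z) carries (3.69) in the form `‖f_X(B′) − f_X(0) − ½q_X‖ ≤ K·t^{6−β}·w_X` with `w_X = exp(−κd_j(X))`
(`eq369_cubic` + `eq369_printed`), `β ≤ 1`, and the tree-decay weights are summable, `Σ_{X∈s} w_X ≤ W` ((2.27)(iv) /
[I] (1.18)), then `‖Σ_X (f_X(B′) − f_X(0)) − ½Σ_X q_X‖ ≤ K·W·t⁵`. [cite: Balaban1988Convergent, (3.70) p.284] -/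
theorem eq370 (s : Finset 𝒳) (fB f0 q : 𝒳 → F) (w : 𝒳 → ℝ) {K W t β : ℝ} (hK : 0 ≤ K) (ht0 : 0 < t)
    (ht1 : t ≤ 1) (hβ : β ≤ 1) (hw : ∀ X ∈ s, 0 ≤ w X) (hW : ∑ X ∈ s, w X ≤ W)
    (h369 : ∀ X ∈ s, ‖fB X - f0 X - (2 : ℝ)⁻¹ • q X‖ ≤ K * t ^ (6 - β) * w X) :
    ‖∑ X ∈ s, (fB X - f0 X) - (2 : ℝ)⁻¹ • ∑ X ∈ s, q X‖ ≤ K * W * t ^ 5 := by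
  have hpow : t ^ (6 - β) ≤ t ^ 5 := by
    have h := Real.rpow_le_rpow_of_exponent_ge ht0 ht1 (show ((5 : ℕ) : ℝ) ≤ 6 - β by push_cast; linarith)
    rwa [Real.rpow_natCast] at h
  have heq : ∑ X ∈ s, (fB X - f0 X) - (2 : ℝ)⁻¹ • ∑ X ∈ s, q X
      = ∑ X ∈ s, (fB X - f0 X - (2 : ℝ)⁻¹ • q X) := by
    rw [Finset.smul_sum, ← Finset.sum_sub_distrib]
  rw [heq]
  have hsw : 0 ≤ ∑ X ∈ s, w X := Finset.sum_nonneg hw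
  calc ‖∑ X ∈ s, (fB X - f0 X - (2 : ℝ)⁻¹ • q X)‖
        ≤ ∑ X ∈ s, ‖fB X - f0 X - (2 : ℝ)⁻¹ • q X‖ := norm_sum_le _ _
    _ ≤ ∑ X ∈ s, K * t ^ (6 - β) * w X := Finset.sum_le_sum h369
    _ = K * t ^ (6 - β) * ∑ X ∈ s, w X := by rw [Finset.mul_sum]
    _ ≤ K * t ^ 5 * ∑ X ∈ s, w X := mul_le_mul_of_nonneg_right (mul_le_mul_of_nonneg_left hpow hK) hsw
    _ ≤ K * t ^ 5 * W := mul_le_mul_of_nonneg_left hW (by positivity)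
    _ = K * W * t ^ 5 := by ring

/-- **(3.70) after the two replacements**: «In the quadratic form above we restrict B′ to □̃^{n−j}, and we replace
the function U_{j,□₀} by U_j, the differences contribute to the last term only» — if the replaced quadratic form `Q`
(whose kernel expansion is `sum_quadratic_eq_kernel370`) differs from `Σ_X q_X` by `‖½Σ_X q_X − ½Q‖ ≤ K′·t⁵`
(hypothesis `hrepl`: print displays no bound for the differences), then
`‖Σ_X (f_X(B′) − f_X(0)) − ½Q‖ ≤ (K·W + K′)·t⁵`, i.e. (3.70) with O(1) = KW + K′.
[cite: Balaban1988Convergent, (3.70) p.284] -/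
theorem eq370_replaced (s : Finset 𝒳) (fB f0 q : 𝒳 → F) (Q : F) (w : 𝒳 → ℝ) {K K' W t β : ℝ} (hK : 0 ≤ K)
    (ht0 : 0 < t) (ht1 : t ≤ 1) (hβ : β ≤ 1) (hw : ∀ X ∈ s, 0 ≤ w X) (hW : ∑ X ∈ s, w X ≤ W)
    (h369 : ∀ X ∈ s, ‖fB X - f0 X - (2 : ℝ)⁻¹ • q X‖ ≤ K * t ^ (6 - β) * w X)
    (hrepl : ‖(2 : ℝ)⁻¹ • ∑ X ∈ s, q X - (2 : ℝ)⁻¹ • Q‖ ≤ K' * t ^ 5) :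
    ‖∑ X ∈ s, (fB X - f0 X) - (2 : ℝ)⁻¹ • Q‖ ≤ (K * W + K') * t ^ 5 := by
  have h1 := eq370 s fB f0 q w hK ht0 ht1 hβ hw hW h369
  have hsplit : ∑ X ∈ s, (fB X - f0 X) - (2 : ℝ)⁻¹ • Q
      = (∑ X ∈ s, (fB X - f0 X) - (2 : ℝ)⁻¹ • ∑ X ∈ s, q X)
        + ((2 : ℝ)⁻¹ • ∑ X ∈ s, q X - (2 : ℝ)⁻¹ • Q) := by abel
  rw [hsplit]
  calc ‖(∑ X ∈ s, (fB X - f0 X) - (2 : ℝ)⁻¹ • ∑ X ∈ s, q X) + ((2 : ℝ)⁻¹ • ∑ X ∈ s, q X - (2 : ℝ)⁻¹ • Q)‖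
        ≤ ‖∑ X ∈ s, (fB X - f0 X) - (2 : ℝ)⁻¹ • ∑ X ∈ s, q X‖ + ‖(2 : ℝ)⁻¹ • ∑ X ∈ s, q X - (2 : ℝ)⁻¹ • Q‖ :=
          norm_add_le _ _
    _ ≤ K * W * t ^ 5 + K' * t ^ 5 := add_le_add h1 hrepl
    _ = (K * W + K') * t ^ 5 := by ring

end Summing

/-! ## §5 (v1.1). The second class of localization domains (p. 283): «can be treated as before» -/

section SecondClass

/-- **The second class `X ∩ (□̃^{n−j})ᶜ ≠ ∅`** (p. 283 [PDF 41]): *«For X in the second class the difference of the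
corresponding expressions can be estimated by 2E₀exp(−½κ(n − j))exp(−½κd_j(X))»* — from the inductive bound
`|𝐄^{(j)}(X, ·, z)| ≤ E₀exp(−κd_j(X))` ((2.27)(iv)) for both terms and `d_j(X) ≥ n − j` for such X (X ∋ z ∈ □ reaches
outside □̃^{n−j}; the geometric input, hypothesis `hd`): `|a − b| ≤ 2E₀e^{−½κ(n−j)}e^{−½κd_j(X)}`.
[cite: Balaban1988Convergent, p.283 (before (3.68))] -/
theorem second_class_le {a b E₀ κ d m : ℝ} (hκ : 0 ≤ κ) (hd : m ≤ d)
    (ha : |a| ≤ E₀ * Real.exp (-(κ * d))) (hb : |b| ≤ E₀ * Real.exp (-(κ * d))) :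
    |a - b| ≤ 2 * E₀ * Real.exp (-(κ * m / 2)) * Real.exp (-(κ * d / 2)) := by
  have hE₀ : 0 ≤ E₀ := by
    have h := (abs_nonneg a).trans ha
    exact nonneg_of_mul_nonneg_left (by simpa [mul_comm] using h) (Real.exp_pos _)
  have hsplit : Real.exp (-(κ * d)) ≤ Real.exp (-(κ * m / 2)) * Real.exp (-(κ * d / 2)) := by
    rw [← Real.exp_add]
    exact Real.exp_le_exp.mpr (by nlinarith)
  calc |a - b| ≤ |a| + |b| := abs_sub _ _
    _ ≤ 2 * (E₀ * Real.exp (-(κ * d))) := by linarith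
    _ ≤ 2 * (E₀ * (Real.exp (-(κ * m / 2)) * Real.exp (-(κ * d / 2)))) := by gcongr
    _ = 2 * E₀ * Real.exp (-(κ * m / 2)) * Real.exp (-(κ * d / 2)) := by ring

/-- **«and exp(−½κ(n − j)) < (L^jL^{−n})⁵, hence these terms can be treated as before»** (p. 283): with `L > 1`,
`j ≤ n` and the decay rate dominating the lattice logarithm, `10·log L ≤ κ` (the smallness the print uses silently),
`exp(−½κ(n − j)) ≤ (L^j/L^n)⁵`. [cite: Balaban1988Convergent, p.283 (before (3.68))] -/
theorem exp_half_kappa_le_pow_five {κ L : ℝ} {j n : ℕ} (hL : 1 < L) (hjn : j ≤ n) (hκ : 10 * Real.log L ≤ κ) :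
    Real.exp (-(κ * ((n : ℝ) - j) / 2)) ≤ (L ^ j / L ^ n) ^ 5 := by
  have hL0 : 0 < L := by linarith
  have hnj : (0 : ℝ) ≤ (n : ℝ) - j := by
    have : (j : ℝ) ≤ n := by exact_mod_cast hjn
    linarith
  have hratio : L ^ j / L ^ n = Real.exp (-(Real.log L * ((n : ℝ) - j))) := by
    rw [Real.exp_neg, ← Real.rpow_natCast L n, ← Real.rpow_natCast L j, ← Real.rpow_sub hL0]
    rw [Real.rpow_def_of_pos hL0, ← Real.exp_neg]
    congr 1
    ring
  rw [hratio, ← Real.exp_nat_mul]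
  refine Real.exp_le_exp.mpr ?_
  push_cast
  nlinarith [Real.log_pos hL]

/-- The two sentences together: for X in the second class the difference is
`≤ 2E₀ (L^jL^{−n})⁵ exp(−½κd_j(X))` — the same shape as the irrelevant remainders of the first class («can be treated
as before»). [cite: Balaban1988Convergent, p.283 (before (3.68))] -/
theorem second_class_irrelevant {a b E₀ κ d L : ℝ} {j n : ℕ} (hL : 1 < L) (hjn : j ≤ n) (hκ : 10 * Real.log L ≤ κ)
    (hd : ((n : ℝ) - j) ≤ d) (ha : |a| ≤ E₀ * Real.exp (-(κ * d))) (hb : |b| ≤ E₀ * Real.exp (-(κ * d))) :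
    |a - b| ≤ 2 * E₀ * (L ^ j / L ^ n) ^ 5 * Real.exp (-(κ * d / 2)) := by
  have hκ0 : 0 ≤ κ := le_trans (by nlinarith [Real.log_pos hL]) hκ
  have h1 := second_class_le hκ0 hd ha hb
  have hE₀ : 0 ≤ E₀ := by
    have h := (abs_nonneg a).trans ha
    exact nonneg_of_mul_nonneg_left (by simpa [mul_comm] using h) (Real.exp_pos _)
  have h2 : Real.exp (-(κ * ((n : ℝ) - j) / 2)) ≤ (L ^ j / L ^ n) ^ 5 := exp_half_kappa_le_pow_five hL hjn hκ
  calc |a - b| ≤ 2 * E₀ * Real.exp (-(κ * ((n : ℝ) - j) / 2)) * Real.exp (-(κ * d / 2)) := h1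
    _ ≤ 2 * E₀ * (L ^ j / L ^ n) ^ 5 * Real.exp (-(κ * d / 2)) := by gcongr

end SecondClass

end Literature.MathematicalPhysics.QuantumFieldTheory.Balaban1983to89.B14.Eq369ThirdOrder
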